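/- Copyright: the b2b-balaban cell (near-miss cell 7), T⁴-continuum fan-out, lineage t4-ne7b-p1 (node U5c COUNT
member).  Released under the licence of the surrounding project. -/
import Summits.QuantumFields.BalabanUV.T4Continuum.Support.HistoryBankingFlatWitness
import Summits.QuantumFields.BalabanUV.T4Continuum.Support.HistoryConstantsTH

/-!
# M5-2c — THE VOLUME PLUG: a live structure's volume factor in the booked-cost currency with `κ := costT`, its
class-linear remainder as a WEIGHTED birth content of the tagged genealogy, and the `p₀²`-weighted credit slack that
absorbs it (owner module of row NE7b, lineage `t4-ne7b-p1` gen 44; re-open object (α), `SCOPE-alpha.md` v2.6,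
`ROW-NE7b-STATE.md` v1.23 §5 (2)(c); M5-2 «the witness plug» part (c); PRE-POSITIONING ONLY)

Summits-side support leaf of the T⁴-continuum cell (rung (B)+1 on a FINITE torus only; NOT infinite volume, NOT the
mass gap, NOT the Clay statement; NOT a proof of the spine estimate NE7b — the cell's OWN estimate, NOT PRINTED, NOT
PROVED).  [folklore] real arithmetic over the TH socket (`HistoryConstantsTH`: `pshapeTH`, `shapeTH`, `birthLinT`,
`creditsT_slack`), the tagged tables (`T4TaggedShapeBanking.costT`, `T4BankedInduction.lifeCost`∕`credits`,
`HistoryConstants.pcredit`), M5-1b∕M5-2a (`HistoryBankingBirthBookings.blin`,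
`HistoryBankingFlatWitness.flat_volume_le_lifeCost_genT`) and the bridge `HistoryGen.Pedigree.shape_genT_eq_toGen`;
nothing printed is asserted, no `def … : Prop` fact of Bałaban's, no cite-tagged hypothesis, zero `sorry`.  One `def`
(`birthWT`, a finite sum).  B16 = [Balaban1989LargeFieldII] pp. 380–387 under audit; locators only.

WHY (M5-2 (c)).  The W-T witness `HistoryRealiseCellsRunApexT3bWT.CountRoadWitnessT3bWT` displays, per live member `q`
of a bad term, `cost_le : lifeCost (padW … 0) (κ K q) q.2 ≤ lifeCost (padW … 0) (costT …) q.2` and the price sentence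
`priceM` against `∏_q pshapeTH … (κ K q) q.2 · e^{−Ξ}`, `pshapeTH = Δ·Λ′^{partnerAges}·e^{−pcredits}·e^{+lifeCost … κ}`.
With **`κ := costT`** the field `cost_le` is `le_rfl`; the live structure's VOLUME factor `exp (Σ_m u_m·compSum id P m)`
(M2 brick B's `Λ K m ^ #domain` regrouped along the pedigree, M5-2b `HistoryBankingForestVolume`) is then to be read
inside `e^{+lifeCost … (costT …) q.2}` — which M5-1b's flat ledger grants up to the class-linear remainder
`2^{d+3}·blin u P`.  THIS FILE books that remainder on the TAGGED genealogy and pays it from the birth-credit slack.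

WHAT.  §1 **`birthWT sh u G`** `:= Σ_{e ∈ G.events, (sh e) a birth} u (sh e).step·((sh e).fat + 1)` (the `u`-weighted
class content; `birthLinT = birthWT 1`); **`creditsT_slack_weighted`**: if `C.a + θ ≤ ½γ₀A₁²` and
`u_j ≤ θ·p₀(g_j)²` at the birth steps, `credits (model) + birthWT sh u G ≤ credits (print)` — NO profile floor needed
(the quadratic credit carries `p₀²`); hence **`pshapeTH_mul_exp_le_shapeTH_of_weighted`** and the product step
**`le_prod_shapeTH_of_slack_weighted`** (a class-linear factor `e^{θ·birthLinT}` AND a weighted one `e^{birthWT u}` per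
member, under `C.a + (θ + θᵥ) ≤ ½γ₀A₁²`).  §2 THE BRIDGE **`blin_eq_birthWT`**: for `relabel sh G = P.toGen` and `G`
well formed, `blin u P = birthWT sh u G`; on a `Pedigree` with `renew_step`: `blin u (toPGen cell c) = birthWT Prod.fst u
(genT c)`.  §3 THE PLUG for a live component `c` (hypotheses of M5-2a verbatim): **`exp_volume_le_genT`**
`exp (Σ_{m≤K} u_m·compSum id (toPGen cell c) m) ≤ exp (lifeCost (dictWT Prod.fst R C.n₁) (costT Prod.fst C K R) (genT c))
· exp (birthWT Prod.fst (2^{d+3}·u) (genT c))`; **`credit_mul_volume_le_pshapeTH_costT`**: print's credit prefactor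
`Δ·Λ′^{partnerAges}·e^{−pcredits}` times the volume factor times `e^{−birthWT Prod.fst (2^{d+3}u)}` is below
`pshapeTH Prod.fst O C Δ Λ′ R g 0 (costT Prod.fst C K R) (genT c)` — the `priceM` shape with `κ := costT`; and
**`credit_mul_volume_le_shapeTH`**: under the slack display `2^{d+3}·u_j ≤ θᵥ·p₀(g_j)²` at the births and
`C.a + θᵥ ≤ ½γ₀A₁²`, the same product WITHOUT the compensating factor is below the TH exit's `shapeTH … K 0 (genT c)`.

WHAT IS *NOT* DONE HERE.  The END twin that takes `κ := costT` and splits its slack `θ` between the slot multiplicity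
and the volume remainder (S12-W crew, by INTERFACE REQUEST), the per-event CREDIT reading of M2-B's `fB`∕`fR` against
`pcredit` and the discount `e^{−Ξ}` ((R1)), the dead genealogies' resummation `resumM`.  HONEST: bookkeeping; NE7b NOT
proved; spine 0∕9.  HONEST DEPENDENCY (cell): continuum YM on T⁴ ⇐ BetaPertH ∧ nine spine estimates (0∕9 proved);
BetaPertH ⇐ (D1) ∧ (D4) ∧ CAP+tail.  This file changes none of it.
-/

open Finset
open Literature.MathematicalPhysics.QuantumFieldTheory.Balaban1983to89
open Literature.MathematicalPhysics.QuantumFieldTheory.Balaban1983to89.B13ScaleTransfer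
open Literature.MathematicalPhysics.QuantumFieldTheory.Balaban1983to89.B16SProfile
open T4PersistenceDictionary T4PrintedShapeBanking T4TaggedShapeBanking T4BankedInduction T4BranchingRecordsGas
open T4PartnerMultiplicity
open Summit.QuantumFields.BalabanUV.T4Continuum.LateMergers
open Summit.QuantumFields.BalabanUV.T4Continuum.HistoryConstants
open Summit.QuantumFields.BalabanUV.T4Continuum.HistoryAdmissible
open Summit.QuantumFields.BalabanUV.T4Continuum.HistoryRealise
open Summit.QuantumFields.BalabanUV.T4Continuum.HistoryRealiseWeak
open Summit.QuantumFields.BalabanUV.T4Continuum.HistoryGen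
open Summit.QuantumFields.BalabanUV.T4Continuum.HistoryBankingPedigreeLedger
open Summit.QuantumFields.BalabanUV.T4Continuum.HistoryBankingBirthBookings
open Summit.QuantumFields.BalabanUV.T4Continuum.HistoryBankingFlatJunction
open Summit.QuantumFields.BalabanUV.T4Continuum.HistoryBankingFlatWitness

namespace Summit.QuantumFields.BalabanUV.T4Continuum.HistoryBankingVolumePlug

noncomputable section

/-! ## §1 The weighted class content of a tagged genealogy and the `p₀²`-weighted credit slack -/

section Weighted

variable {ε : Type*} [DecidableEq ε] {C : T4PrintedShapeBanking.Consts} {O : PrintedO1s} (sh : ε → PEv)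

/-- **THE WEIGHTED CLASS CONTENT THROUGH THE SHAPE**: `Σ_{e ∈ events, (sh e) a birth} u_{(sh e).step}·((sh e).fat + 1)`
(`birthLinT` is the weight `1`). [folklore] -/
def birthWT (sh : ε → PEv) (u : ℕ → ℝ) (G : Gen ε) : ℝ :=
  ∑ e ∈ G.events with (sh e).kind = 0, u (sh e).step * (((sh e).fat : ℝ) + 1)

/-- the weighted class content is nonnegative for `u ≥ 0` [folklore] -/
theorem birthWT_nonneg {u : ℕ → ℝ} (hu : ∀ n, 0 ≤ u n) (G : Gen ε) : 0 ≤ birthWT sh u G :=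
  Finset.sum_nonneg fun e _ => mul_nonneg (hu _) (by positivity)

/-- the weighted class content is linear in the weight: scalars [folklore] -/
theorem birthWT_smul (a : ℝ) (u : ℕ → ℝ) (G : Gen ε) : birthWT sh (fun n => a * u n) G = a * birthWT sh u G := by
  unfold birthWT
  rw [Finset.mul_sum]
  exact Finset.sum_congr rfl fun e _ => by ring

/-- the weighted class content is linear in the weight: sums [folklore] -/
theorem birthWT_add (u v : ℕ → ℝ) (G : Gen ε) :
    birthWT sh (fun n => u n + v n) G = birthWT sh u G + birthWT sh v G := by
  unfold birthWT
  rw [← Finset.sum_add_distrib]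
  exact Finset.sum_congr rfl fun e _ => by ring

/-- the class-linear content is the weighted one at the constant weight: `θ·birthLinT = birthWT (θ)` [folklore] -/
theorem mul_birthLinT_eq_birthWT (θ : ℝ) (G : Gen ε) : θ * birthLinT sh G = birthWT sh (fun _ => θ) G := by
  unfold birthLinT birthWT
  rw [Finset.mul_sum]

/-- **THE `p₀²`-WEIGHTED CREDIT SLACK**: with `C.a + θ ≤ ½γ₀A₁²` and `u_j ≤ θ·p₀(g_j)²` at the genealogy's birth steps,
print's credits exceed the model's by at least `birthWT sh u G` — NO profile floor is needed, the quadratic birth credit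
carries `p₀²` itself. [folklore] -/
theorem creditsT_slack_weighted {θ : ℝ} (hslack : C.a + θ ≤ O.γ₀ * O.A₁ ^ 2 / 2) (g : ℕ → ℝ) {u : ℕ → ℝ}
    {G : Gen ε} (hu : ∀ e ∈ G.events, (sh e).kind = 0 → u (sh e).step ≤ θ * p0Profile C.A₀ C.p₀ (g (sh e).step) ^ 2) :
    credits (credit C g ∘ sh) G + birthWT sh u G ≤ credits (pcredit O C g ∘ sh) G := by
  unfold credits birthWT
  rw [Finset.sum_filter, ← Finset.sum_add_distrib]
  refine Finset.sum_le_sum fun e he => ?_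
  simp only [Function.comp_apply]
  by_cases h0 : (sh e).kind = 0
  · rw [if_pos h0, credit_kind0 h0, pcredit_kind0 h0]
    have h1 := hu e he h0
    have hf : (0 : ℝ) ≤ ((sh e).fat : ℝ) + 1 := by positivity
    have hp : 0 ≤ p0Profile C.A₀ C.p₀ (g (sh e).step) ^ 2 := sq_nonneg _
    nlinarith [mul_le_mul_of_nonneg_right h1 hf, mul_le_mul_of_nonneg_right hslack (mul_nonneg hp hf)]
  · rw [if_neg h0, add_zero]
    by_cases h1 : (sh e).kind = 1
    · rw [credit_kind1 h1, pcredit_kind1 h1]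
    · have h2 : (sh e).kind = 2 := by
        generalize hk : (sh e).kind = k at h0 h1 ⊢
        fin_cases k <;> simp_all
      rw [credit_kind2 h2, pcredit_kind2 h2]

/-- **PRINT-PRICED TH SHAPE × WEIGHTED CLASS FACTOR ≤ THE TH EXIT'S SHAPE** under the slack junction `C.a + θ ≤ ½γ₀A₁²`,
the weight display `u_j ≤ θ·p₀(g_j)²` at the birth steps, and a realised cost read below `costT` (for `κ := costT`:
`le_rfl`). [folklore] -/
theorem pshapeTH_mul_exp_le_shapeTH_of_weighted {θ : ℝ} (hslack : C.a + θ ≤ O.γ₀ * O.A₁ ^ 2 / 2) {Δ Λ' : ℝ}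
    (hΔ : 0 ≤ Δ) (hΛ : 0 ≤ Λ') (R : ℕ → ℕ) (g : ℕ → ℝ) (K D : ℕ) {κ : Gen ε → ℕ → ℝ} {G : Gen ε} {u : ℕ → ℝ}
    (hu : ∀ e ∈ G.events, (sh e).kind = 0 → u (sh e).step ≤ θ * p0Profile C.A₀ C.p₀ (g (sh e).step) ^ 2)
    (h : ∀ n ∈ life (padW (dictWT sh R C.n₁) D) G, κ G n ≤ costT sh C K R G n) :
    pshapeTH sh O C Δ Λ' R g D κ G * Real.exp (birthWT sh u G) ≤ shapeTH sh C Δ Λ' R g K D G := by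
  unfold pshapeTH shapeTH
  have hc : Real.exp (-credits (pcredit O C g ∘ sh) G) * Real.exp (birthWT sh u G) ≤
      Real.exp (-credits (credit C g ∘ sh) G) := by
    rw [← Real.exp_add]
    exact Real.exp_le_exp.2 (by linarith [creditsT_slack_weighted sh hslack g hu])
  have hl : Real.exp (lifeCost (padW (dictWT sh R C.n₁) D) κ G) ≤
      Real.exp (lifeCost (padW (dictWT sh R C.n₁) D) (costT sh C K R) G) :=
    Real.exp_le_exp.2 (lifeCostT_mono h)
  have hraw : Real.exp (-credits (pcredit O C g ∘ sh) G) * Real.exp (lifeCost (padW (dictWT sh R C.n₁) D) κ G) *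
      Real.exp (birthWT sh u G) ≤ Real.exp (-credits (credit C g ∘ sh) G) *
        Real.exp (lifeCost (padW (dictWT sh R C.n₁) D) (costT sh C K R) G) := by
    calc _ = Real.exp (-credits (pcredit O C g ∘ sh) G) * Real.exp (birthWT sh u G) *
          Real.exp (lifeCost (padW (dictWT sh R C.n₁) D) κ G) := by ring
      _ ≤ _ := mul_le_mul hc hl (Real.exp_pos _).le (Real.exp_pos _).le
  have hpre : 0 ≤ Δ * Λ' ^ partnerAges (PEv.step ∘ sh) G := mul_nonneg hΔ (pow_nonneg hΛ _)
  calc _ = Δ * Λ' ^ partnerAges (PEv.step ∘ sh) G * (Real.exp (-credits (pcredit O C g ∘ sh) G) *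
        Real.exp (lifeCost (padW (dictWT sh R C.n₁) D) κ G) * Real.exp (birthWT sh u G)) := by ring
    _ ≤ Δ * Λ' ^ partnerAges (PEv.step ∘ sh) G * (Real.exp (-credits (credit C g ∘ sh) G) *
        Real.exp (lifeCost (padW (dictWT sh R C.n₁) D) (costT sh C K R) G)) :=
      mul_le_mul_of_nonneg_left hraw hpre
    _ = _ := by ring

/-- a class-linear factor `e^{θ·birthLinT}` and a weighted one `e^{birthWT u}` combine into ONE weighted factor whose
weight `θ + u_j` is below `(θ + θᵥ)·p₀(g_j)²` when `θ ≥ 0`, the profile is `≥ 1` and `u_j ≤ θᵥ·p₀(g_j)²` at the births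
[folklore] -/
theorem exp_mul_exp_eq_exp_birthWT (θ : ℝ) (u : ℕ → ℝ) (G : Gen ε) :
    Real.exp (θ * birthLinT sh G) * Real.exp (birthWT sh u G) = Real.exp (birthWT sh (fun n => θ + u n) G) := by
  rw [← Real.exp_add, mul_birthLinT_eq_birthWT, ← birthWT_add]

/-- **THE PRODUCT STEP WITH BOTH SLACK FACTORS**: a class price below
`∏ mult q · pshapeTH … (κ q) (gen q) · e^{θ·birthLinT (gen q)} · e^{birthWT sh (u q) (gen q)}` is below
`∏ mult q · shapeTH … (gen q)` under the COMBINED slack `C.a + (θ + θᵥ) ≤ ½γ₀A₁²` (`θ ≥ 0`), the profile floor `≥ 1` at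
the births (for the class-linear factor), the weight display `u q j ≤ θᵥ·p₀(g_j)²` at the births, and realised costs
read below `costT` — the END's slot-multiplicity slack and the volume remainder's slack SHARE print's room
`½γ₀A₁² − C.a`. [folklore] -/
theorem le_prod_shapeTH_of_slack_weighted {θ θv : ℝ} (hθ : 0 ≤ θ)
    (hslack : C.a + (θ + θv) ≤ O.γ₀ * O.A₁ ^ 2 / 2) {Δ Λ' : ℝ} (hΔ : 0 ≤ Δ) (hΛ : 0 ≤ Λ') (R : ℕ → ℕ)
    (g : ℕ → ℝ) (K D : ℕ) {ι : Type*} (S : Finset ι) (gen : ι → Gen ε) {mult : ι → ℝ}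
    (hmult : ∀ q ∈ S, 0 ≤ mult q) (κ : ι → Gen ε → ℕ → ℝ) (u : ι → ℕ → ℝ)
    (hP : ∀ q ∈ S, ∀ e ∈ (gen q).events, (sh e).kind = 0 → 1 ≤ p0Profile C.A₀ C.p₀ (g (sh e).step))
    (hu : ∀ q ∈ S, ∀ e ∈ (gen q).events, (sh e).kind = 0 →
      u q (sh e).step ≤ θv * p0Profile C.A₀ C.p₀ (g (sh e).step) ^ 2)
    (h : ∀ q ∈ S, ∀ n ∈ life (padW (dictWT sh R C.n₁) D) (gen q), κ q (gen q) n ≤ costT sh C K R (gen q) n)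
    {x : ℝ} (hx : x ≤ ∏ q ∈ S, mult q * (pshapeTH sh O C Δ Λ' R g D (κ q) (gen q) *
      Real.exp (θ * birthLinT sh (gen q)) * Real.exp (birthWT sh (u q) (gen q)))) :
    x ≤ ∏ q ∈ S, mult q * shapeTH sh C Δ Λ' R g K D (gen q) := by
  have hw : ∀ q ∈ S, ∀ e ∈ (gen q).events, (sh e).kind = 0 →
      θ + u q (sh e).step ≤ (θ + θv) * p0Profile C.A₀ C.p₀ (g (sh e).step) ^ 2 := fun q hq e he h0 => by
    have h1 := hP q hq e he h0
    have hsq : 1 ≤ p0Profile C.A₀ C.p₀ (g (sh e).step) ^ 2 := by nlinarith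
    nlinarith [hu q hq e he h0, mul_le_mul_of_nonneg_left hsq hθ]
  refine hx.trans (prod_le_prod (fun q hq => mul_nonneg (hmult q hq) (mul_nonneg (mul_nonneg
    (pshapeTH_nonneg sh hΔ hΛ R g D _ _) (Real.exp_pos _).le) (Real.exp_pos _).le)) fun q hq => ?_)
  rw [mul_assoc (pshapeTH sh O C Δ Λ' R g D (κ q) (gen q)), exp_mul_exp_eq_exp_birthWT]
  exact mul_le_mul_of_nonneg_left
    (pshapeTH_mul_exp_le_shapeTH_of_weighted sh hslack hΔ hΛ R g K D (hw q hq) (h q hq)) (hmult q hq)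

end Weighted

/-! ## §2 The bridge: the pedigree's weighted class content IS the tagged genealogy's -/

section Bridge

variable {γ : Type*} {ε : Type*} [DecidableEq ε] (sh : ε → PEv)

/-- **`blin u P = birthWT sh u G`** for a well-formed tagged genealogy `G` whose shape-relabelling is `P`'s canonical
genealogy: births correspond to the kind-`0` events (step `j`, fat `cls`), renewal and merger labels are of kinds `1`,
`2` and distinct from the partners' disjoint event sets (`Gen.WF`). [folklore] -/
theorem blin_eq_birthWT (u : ℕ → ℝ) {W : ε → ℕ} :
    ∀ (P : PGen γ) (G : Gen ε), relabel sh G = P.toGen → G.WF W → blin u P = birthWT sh u G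
  | .birth j cls z, G, hsh, _ => by
      obtain ⟨b, j', rfl⟩ : ∃ b j', G = Gen.born b j' := by
        cases G with
        | born b j' => exact ⟨b, j', rfl⟩
        | renew _ _ _ => simp [PGen.toGen] at hsh
        | merge _ _ _ => simp [PGen.toGen] at hsh
      simp only [PGen.toGen, relabel_born, Gen.born.injEq] at hsh
      obtain ⟨hb, rfl⟩ := hsh
      have hk : (sh b).kind = 0 := by rw [hb]; rfl
      unfold blin birthWT
      rw [Gen.events_born, Finset.filter_singleton, if_pos hk, Finset.sum_singleton, hb]
      rfl
  | .renew Q h, G, hsh, hW => by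
      obtain ⟨G', e, h', rfl⟩ : ∃ G' e h', G = Gen.renew G' e h' := by
        cases G with
        | born _ _ => simp [PGen.toGen] at hsh
        | renew G' e h' => exact ⟨G', e, h', rfl⟩
        | merge _ _ _ => simp [PGen.toGen] at hsh
      simp only [PGen.toGen, relabel_renew, Gen.renew.injEq] at hsh
      simp only [Gen.WF] at hW
      have hk : ¬ (sh e).kind = 0 := by rw [hsh.2.1]; simp [PEv.kind]
      have ih := blin_eq_birthWT u Q G' hsh.1 hW.1
      unfold birthWT
      rw [Gen.events_renew, Finset.filter_insert, if_neg hk]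
      exact ih
  | .join X Y sj, G, hsh, hW => by
      obtain ⟨GX, GY, e, rfl⟩ : ∃ GX GY e, G = Gen.merge GX GY e := by
        cases G with
        | born _ _ => simp [PGen.toGen] at hsh
        | renew _ _ _ => simp [PGen.toGen] at hsh
        | merge GX GY e => exact ⟨GX, GY, e, rfl⟩
      simp only [PGen.toGen, relabel_merge, Gen.merge.injEq] at hsh
      simp only [Gen.WF] at hW
      obtain ⟨hWX, hWY, -, -, hXY, -, -⟩ := hW
      have hk : ¬ (sh e).kind = 0 := by rw [hsh.2.2]; simp [PEv.kind]
      have ihX := blin_eq_birthWT u X GX hsh.1 hWX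
      have ihY := blin_eq_birthWT u Y GY hsh.2.1 hWY
      change blin u X + blin u Y = _
      unfold birthWT at ihX ihY ⊢
      rw [Gen.events_merge, Finset.filter_insert, if_neg hk, Finset.filter_union,
        Finset.sum_union (Finset.disjoint_filter_filter hXY), ihX, ihY]

variable {α π : Type*}

omit [DecidableEq ε] in
/-- the weighted class content is blind to `shape` (kind, step and — for births — fat are kept) [folklore] -/
theorem birthWT_shape_comp [DecidableEq α] [DecidableEq π] (u : ℕ → ℝ) (G : Gen (Lab α π)) :
    birthWT (shape ∘ Prod.fst) u G = birthWT Prod.fst u G := by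
  unfold birthWT
  refine Finset.sum_congr (by simp only [Function.comp_apply, kind_shape]) fun e he => ?_
  simp only [Finset.mem_filter] at he
  simp only [Function.comp_apply, step_shape, fat_shape_of_kind0 he.2]

/-- **ON A `Pedigree` WITH `renew_step`**: the weighted class content of a component's geometric pedigree
`toPGen cell c` is that of its tagged genealogy `genT c` through `Prod.fst`, whenever the latter is well formed (the
bridge `shape_genT_eq_toGen`). [folklore] -/
theorem blin_toPGen_eq_birthWT_genT [DecidableEq α] [DecidableEq π] [Inhabited γ] (Pd : Pedigree α π)
    (cell : π → γ) (hS : ∀ c c', Part.old c' true ∈ Pd.parts c → Pd.step c' + 1 = Pd.step c) (c : α)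
    {W : Lab α π → ℕ} (hW : (Pd.genT c).WF W) (u : ℕ → ℝ) :
    blin u (Pd.toPGen cell c) = birthWT Prod.fst u (Pd.genT c) := by
  rw [← birthWT_shape_comp, ← blin_eq_birthWT (shape ∘ Prod.fst) u _ _ (Pd.shape_genT_eq_toGen cell hS c) hW]

end Bridge

/-! ## §3 The plug: a live component's volume factor in the booked-cost currency, `κ := costT` -/

section Plug

variable {d : ℕ} {L : ℕ} {s R : ℕ → ℕ} {C : T4PrintedShapeBanking.Consts} {α π : Type*} [DecidableEq α]
  [DecidableEq π]

/-- **THE LIVE VOLUME FACTOR IN THE BOOKED-COST CURRENCY** (hypotheses of M5-2a's `flat_volume_le_lifeCost_genT`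
verbatim): `exp (Σ_{m≤K} u_m·compSum id (toPGen cell c) m) ≤ exp (lifeCost (dictWT Prod.fst R C.n₁) (costT Prod.fst C K R)
(genT c)) · exp (birthWT Prod.fst (2^{d+3}·u) (genT c))`. [folklore] -/
theorem exp_volume_le_genT (hL : 4 ≤ L) (hdrop : ∀ m, DropCtl s m) (hR : ∀ t, 1 ≤ R t)
    (hn₁ : 13 ≤ C.n₁) (hE₂ : 0 ≤ C.E₂) (hE₃ : 0 ≤ C.E₃) (Pd : Pedigree α π)
    (cell : π → Pt d × Finset (Pt d)) (hS : ∀ c c', Part.old c' true ∈ Pd.parts c → Pd.step c' + 1 = Pd.step c)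
    (c : α) {Z : Finset (Pt d)} (hP : RealisesW L s R (Pd.toPGen cell c) Z)
    (hW : (Pd.genT c).WF (dictWT Prod.fst R C.n₁)) {K : ℕ} (hPK : (Pd.toPGen cell c).lastStep ≤ K)
    (hK : K < (Pd.genT c).reach (dictWT Prod.fst R C.n₁)) {u : ℕ → ℝ} (hu : ∀ n, 0 ≤ u n) {Lu : ℝ}
    (hLu0 : 0 < Lu) {j : ℕ} (hj1 : 1 ≤ j) (hLu : ∀ t i, i ≤ j → u (t + i) ≤ Lu * u t)
    (hsmall : (1122 : ℝ) ^ d * 16 * 21 ^ d * Lu ≤ 2 ^ j / 2)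
    (huΦ : ∀ t, t ≤ K → u t * (6 * (561 ^ d * j * Lu + 1122 ^ d * Lu)) ≤ floorK C K R t)
    (huE₂ : ∀ n, n ≤ K → u n * (15 * 126 ^ d) ≤ C.E₂ * (R n : ℝ) ^ C.q')
    (huE₃ : ∀ n, n ≤ K → u n * (24 * 126 ^ d) ≤ C.E₃ * (R n : ℝ) ^ C.q') :
    Real.exp (∑ m ∈ Finset.range (K + 1), u m * compSum L s (fun v => (v : ℝ)) (Pd.toPGen cell c) m) ≤
      Real.exp (lifeCost (dictWT Prod.fst R C.n₁) (costT Prod.fst C K R) (Pd.genT c)) *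
        Real.exp (birthWT Prod.fst (fun n => 2 ^ (d + 3) * u n) (Pd.genT c)) := by
  rw [← Real.exp_add, Real.exp_le_exp, birthWT_smul, ← blin_toPGen_eq_birthWT_genT Pd cell hS c hW u]
  exact flat_volume_le_lifeCost_genT hL hdrop hR hn₁ hE₂ hE₃ Pd cell hS c hP hW hPK hK hu hLu0 hj1 hLu hsmall huΦ
    huE₂ huE₃

/-- **THE `priceM` SHAPE WITH `κ := costT`**: print's credit prefactor `Δ·Λ′^{partnerAges}·e^{−pcredits}` of the live
member, times its volume factor, times the compensating factor `e^{−birthWT Prod.fst (2^{d+3}u) (genT c)}`, is below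
`pshapeTH Prod.fst O C Δ Λ′ R g 0 (costT Prod.fst C K R) (genT c)` (delay `0`: the padded table is the table itself) —
and `cost_le` for `κ := costT` is `le_rfl`. [folklore] -/
theorem credit_mul_volume_le_pshapeTH_costT (O : PrintedO1s) (Δ Λ' : ℝ) (g : ℕ → ℝ) (hL : 4 ≤ L)
    (hdrop : ∀ m, DropCtl s m) (hR : ∀ t, 1 ≤ R t) (hn₁ : 13 ≤ C.n₁) (hE₂ : 0 ≤ C.E₂) (hE₃ : 0 ≤ C.E₃)
    (Pd : Pedigree α π) (cell : π → Pt d × Finset (Pt d))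
    (hS : ∀ c c', Part.old c' true ∈ Pd.parts c → Pd.step c' + 1 = Pd.step c) (c : α) {Z : Finset (Pt d)}
    (hP : RealisesW L s R (Pd.toPGen cell c) Z) (hW : (Pd.genT c).WF (dictWT Prod.fst R C.n₁)) {K : ℕ}
    (hPK : (Pd.toPGen cell c).lastStep ≤ K) (hK : K < (Pd.genT c).reach (dictWT Prod.fst R C.n₁)) {u : ℕ → ℝ}
    (hu : ∀ n, 0 ≤ u n) {Lu : ℝ} (hLu0 : 0 < Lu) {j : ℕ} (hj1 : 1 ≤ j) (hLu : ∀ t i, i ≤ j → u (t + i) ≤ Lu * u t)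
    (hsmall : (1122 : ℝ) ^ d * 16 * 21 ^ d * Lu ≤ 2 ^ j / 2)
    (huΦ : ∀ t, t ≤ K → u t * (6 * (561 ^ d * j * Lu + 1122 ^ d * Lu)) ≤ floorK C K R t)
    (huE₂ : ∀ n, n ≤ K → u n * (15 * 126 ^ d) ≤ C.E₂ * (R n : ℝ) ^ C.q')
    (huE₃ : ∀ n, n ≤ K → u n * (24 * 126 ^ d) ≤ C.E₃ * (R n : ℝ) ^ C.q') :
    0 ≤ Δ → 0 ≤ Λ' →
      Δ * (Λ' ^ partnerAges (PEv.step ∘ Prod.fst) (Pd.genT c) *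
          Real.exp (-credits (pcredit O C g ∘ Prod.fst) (Pd.genT c))) *
        Real.exp (∑ m ∈ Finset.range (K + 1), u m * compSum L s (fun v => (v : ℝ)) (Pd.toPGen cell c) m) *
        Real.exp (-birthWT Prod.fst (fun n => 2 ^ (d + 3) * u n) (Pd.genT c)) ≤
      pshapeTH Prod.fst O C Δ Λ' R g 0 (costT Prod.fst C K R) (Pd.genT c) := by
  intro hΔ hΛ
  have h := exp_volume_le_genT hL hdrop hR hn₁ hE₂ hE₃ Pd cell hS c hP hW hPK hK hu hLu0 hj1 hLu hsmall huΦ huE₂ huE₃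
  unfold pshapeTH
  rw [padW_zero]
  have hvol : Real.exp (∑ m ∈ Finset.range (K + 1), u m * compSum L s (fun v => (v : ℝ)) (Pd.toPGen cell c) m) *
      Real.exp (-birthWT Prod.fst (fun n => 2 ^ (d + 3) * u n) (Pd.genT c)) ≤
        Real.exp (lifeCost (dictWT Prod.fst R C.n₁) (costT Prod.fst C K R) (Pd.genT c)) := by
    have hB := Real.exp_pos (-birthWT Prod.fst (fun n => 2 ^ (d + 3) * u n) (Pd.genT c))
    calc _ ≤ Real.exp (lifeCost (dictWT Prod.fst R C.n₁) (costT Prod.fst C K R) (Pd.genT c)) *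
          Real.exp (birthWT Prod.fst (fun n => 2 ^ (d + 3) * u n) (Pd.genT c)) *
          Real.exp (-birthWT Prod.fst (fun n => 2 ^ (d + 3) * u n) (Pd.genT c)) :=
        mul_le_mul_of_nonneg_right h hB.le
      _ = _ := by rw [mul_assoc, ← Real.exp_add, add_neg_cancel, Real.exp_zero, mul_one]
  have hpre : 0 ≤ Δ * (Λ' ^ partnerAges (PEv.step ∘ Prod.fst) (Pd.genT c) *
      Real.exp (-credits (pcredit O C g ∘ Prod.fst) (Pd.genT c))) :=
    mul_nonneg hΔ (mul_nonneg (pow_nonneg hΛ _) (Real.exp_pos _).le)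
  calc _ = Δ * (Λ' ^ partnerAges (PEv.step ∘ Prod.fst) (Pd.genT c) *
        Real.exp (-credits (pcredit O C g ∘ Prod.fst) (Pd.genT c))) *
        (Real.exp (∑ m ∈ Finset.range (K + 1), u m * compSum L s (fun v => (v : ℝ)) (Pd.toPGen cell c) m) *
          Real.exp (-birthWT Prod.fst (fun n => 2 ^ (d + 3) * u n) (Pd.genT c))) := by ring
    _ ≤ Δ * (Λ' ^ partnerAges (PEv.step ∘ Prod.fst) (Pd.genT c) *
        Real.exp (-credits (pcredit O C g ∘ Prod.fst) (Pd.genT c))) *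
        Real.exp (lifeCost (dictWT Prod.fst R C.n₁) (costT Prod.fst C K R) (Pd.genT c)) :=
      mul_le_mul_of_nonneg_left hvol hpre
    _ = _ := by ring

/-- **… AND, UNDER THE VOLUME SLACK, BELOW THE TH EXIT'S SHAPE WITHOUT THE COMPENSATING FACTOR**: with
`C.a + θᵥ ≤ ½γ₀A₁²` and the display `2^{d+3}·u_j ≤ θᵥ·p₀(g_j)²` at the births of `genT c`, print's credit prefactor times
the live volume factor is below `shapeTH Prod.fst C Δ Λ′ R g K 0 (genT c)` — the volume's class-linear remainder is paid
by the birth-credit slack (`pshapeTH_mul_exp_le_shapeTH_of_weighted` at `κ := costT`). [folklore] -/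
theorem credit_mul_volume_le_shapeTH {O : PrintedO1s} {θv : ℝ} (hslack : C.a + θv ≤ O.γ₀ * O.A₁ ^ 2 / 2)
    {Δ Λ' : ℝ} (hΔ : 0 ≤ Δ) (hΛ : 0 ≤ Λ') (g : ℕ → ℝ) (hL : 4 ≤ L) (hdrop : ∀ m, DropCtl s m)
    (hR : ∀ t, 1 ≤ R t) (hn₁ : 13 ≤ C.n₁) (hE₂ : 0 ≤ C.E₂) (hE₃ : 0 ≤ C.E₃) (Pd : Pedigree α π)
    (cell : π → Pt d × Finset (Pt d)) (hS : ∀ c c', Part.old c' true ∈ Pd.parts c → Pd.step c' + 1 = Pd.step c)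
    (c : α) {Z : Finset (Pt d)} (hP : RealisesW L s R (Pd.toPGen cell c) Z)
    (hW : (Pd.genT c).WF (dictWT Prod.fst R C.n₁)) {K : ℕ} (hPK : (Pd.toPGen cell c).lastStep ≤ K)
    (hK : K < (Pd.genT c).reach (dictWT Prod.fst R C.n₁)) {u : ℕ → ℝ} (hu : ∀ n, 0 ≤ u n) {Lu : ℝ}
    (hLu0 : 0 < Lu) {j : ℕ} (hj1 : 1 ≤ j) (hLu : ∀ t i, i ≤ j → u (t + i) ≤ Lu * u t)
    (hsmall : (1122 : ℝ) ^ d * 16 * 21 ^ d * Lu ≤ 2 ^ j / 2)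
    (huΦ : ∀ t, t ≤ K → u t * (6 * (561 ^ d * j * Lu + 1122 ^ d * Lu)) ≤ floorK C K R t)
    (huE₂ : ∀ n, n ≤ K → u n * (15 * 126 ^ d) ≤ C.E₂ * (R n : ℝ) ^ C.q')
    (huE₃ : ∀ n, n ≤ K → u n * (24 * 126 ^ d) ≤ C.E₃ * (R n : ℝ) ^ C.q')
    (huθ : ∀ e ∈ (Pd.genT c).events, (Prod.fst e).kind = 0 →
      2 ^ (d + 3) * u (Prod.fst e).step ≤ θv * p0Profile C.A₀ C.p₀ (g (Prod.fst e).step) ^ 2) :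
    Δ * (Λ' ^ partnerAges (PEv.step ∘ Prod.fst) (Pd.genT c) *
          Real.exp (-credits (pcredit O C g ∘ Prod.fst) (Pd.genT c))) *
        Real.exp (∑ m ∈ Finset.range (K + 1), u m * compSum L s (fun v => (v : ℝ)) (Pd.toPGen cell c) m) ≤
      shapeTH Prod.fst C Δ Λ' R g K 0 (Pd.genT c) := by
  have h1 := credit_mul_volume_le_pshapeTH_costT O Δ Λ' g hL hdrop hR hn₁ hE₂ hE₃ Pd cell hS c hP hW hPK hK hu hLu0 hj1
    hLu hsmall huΦ huE₂ huE₃ hΔ hΛ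
  have h2 := pshapeTH_mul_exp_le_shapeTH_of_weighted (Prod.fst : Lab α π → PEv) hslack hΔ hΛ R g K 0
    (κ := costT Prod.fst C K R) (G := Pd.genT c) (u := fun n => 2 ^ (d + 3) * u n) huθ (fun _ _ => le_rfl)
  have hB := Real.exp_pos (birthWT Prod.fst (fun n => 2 ^ (d + 3) * u n) (Pd.genT c))
  have h3 := mul_le_mul_of_nonneg_right h1 hB.le
  rw [mul_assoc _ (Real.exp (-birthWT Prod.fst (fun n => 2 ^ (d + 3) * u n) (Pd.genT c))), ← Real.exp_add,
    neg_add_cancel, Real.exp_zero, mul_one] at h3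
  exact h3.trans h2

end Plug

end

end Summit.QuantumFields.BalabanUV.T4Continuum.HistoryBankingVolumePlug
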